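import Summits.MatrixMultiplication.MatrixMultiplication.Theorems.SoloBlindConjEReduction

/-!
# The twin move: Conjecture E reduces to zero-sum-free SETS (all ranks)

Sub-programme (K₃) (Kraft inequality for zero-sum-free sequences over `𝔽₃`), H-good half, continued from
`SoloBlindConjEReduction` (Kraft mass `soloBlindMass`, Conjecture E: `E(τ; S) ≤ 1/2` for H-good `τ`).

THE TWIN MOVE.  Let `h` be zero-sum free on `S` in a group of exponent `3`, and let `x ≠ x'` in `S` be TWINS,
`h x' = h x`.  For any additive `π` with kernel `{0, h x, h x + h x}`:
* `π ∘ h` is zero-sum free on `S \ {x, x'}` (`soloBlind_twin_zsf`): a sub-sum in the kernel is completed to a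
  zero sum by `x` or by `x, x'`;
* if `τ` is H-good on `S` then `π τ` is H-good for `π ∘ h` on `S \ {x, x'}` (`soloBlind_twin_hgood`), by the same
  completions;
* `E(τ; S) ≤ E'(π τ; S \ {x, x'})` (`soloBlind_mass_twin_move`): the fibre of `M ↦ M \ {x, x'}` over a
  representation `U` of `π τ` is `{U}` (if `∑_U h = τ`), or inside `{U ∪ {x}, U ∪ {x'}}` (if `∑_U h = τ - h x`),
  or inside `{U ∪ {x, x'}}` (otherwise), of mass `≤ 2^{-|U|}` in each case.

THE REDUCTION TO SETS (`soloBlind_conjE_of_sets`): if Conjecture E holds for every exponent-`3` group (of a fixed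
universe), every INJECTIVE zero-sum-free `h` on `S` (a zero-sum-free SET) and every H-good target all of whose
representations have size `≥ 3`, then Conjecture E holds for all zero-sum-free sequences and all H-good targets.
(Strong induction on `|S|`: members of size `1` and `2` are removed by `SoloBlindConjEReduction` and the pair move in
`G ⧸ ℤ(h y - h x)`; twins are removed by the twin move in `G ⧸ ℤ(h x)`.)
-/

namespace Summit.MatrixMultiplication.MatrixMultiplication.Theorems

open Finset

universe u

variable {ι : Type*} [DecidableEq ι]
variable {G : Type u} [AddCommGroup G] [DecidableEq G]
variable {G' : Type u} [AddCommGroup G'] [DecidableEq G']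

omit [DecidableEq G] [DecidableEq G'] in
/-- TWIN MOVE, zero-sum-freeness: if `h x' = h x` for `x ≠ x'` in `S` and `π` has kernel `{0, h x, h x + h x}`,
then `π ∘ h` is zero-sum free on `S \ {x, x'}`. -/
theorem soloBlind_twin_zsf (three : ∀ g : G, g + g + g = 0) {h : ι → G} {S : Finset ι}
    (zsf : ∀ T ⊆ S, T.Nonempty → ∑ i ∈ T, h i ≠ 0) {x x' : ι} (hx : x ∈ S) (hx' : x' ∈ S)
    (hxx' : x ≠ x') (htwin : h x' = h x) (π : G →+ G')
    (hker : ∀ g : G, π g = 0 → g = 0 ∨ g = h x ∨ g = h x + h x) :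
    ∀ T ⊆ S \ {x, x'}, T.Nonempty → ∑ i ∈ T, π (h i) ≠ 0 := by
  intro T hT hne hsum
  have hTS : T ⊆ S := fun i hi => (Finset.mem_sdiff.mp (hT hi)).1
  have hxT : x ∉ T := fun hi => (Finset.mem_sdiff.mp (hT hi)).2 (by simp)
  have hx'T : x' ∉ T := fun hi => (Finset.mem_sdiff.mp (hT hi)).2 (by simp)
  have hx'' : x ∉ insert x' T := by
    rw [Finset.mem_insert]; push Not; exact ⟨hxx', hxT⟩
  have hπ : π (∑ i ∈ T, h i) = 0 := by rw [map_sum]; exact hsum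
  rcases hker _ hπ with h0 | h1 | h2
  · exact zsf T hTS hne h0
  · refine zsf (insert x (insert x' T)) ?_ (Finset.insert_nonempty _ _) ?_
    · exact Finset.insert_subset hx (Finset.insert_subset hx' hTS)
    · rw [Finset.sum_insert hx'', Finset.sum_insert hx'T, h1, htwin, ← add_assoc, three]
  · refine zsf (insert x T) (Finset.insert_subset hx hTS) (Finset.insert_nonempty _ _) ?_
    rw [Finset.sum_insert hxT, h2, ← add_assoc, three]

omit [DecidableEq G] [DecidableEq G'] in
/-- TWIN MOVE, H-goodness: under the same hypotheses, if `τ` is H-good on `S` then `π τ` is H-good for `π ∘ h` on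
`S \ {x, x'}`. -/
theorem soloBlind_twin_hgood (three : ∀ g : G, g + g + g = 0) {h : ι → G} {S : Finset ι} {τ : G}
    (hgood : ∀ T ⊆ S, ∑ i ∈ T, h i ≠ τ + τ) {x x' : ι} (hx : x ∈ S) (hx' : x' ∈ S)
    (hxx' : x ≠ x') (htwin : h x' = h x) (π : G →+ G')
    (hker : ∀ g : G, π g = 0 → g = 0 ∨ g = h x ∨ g = h x + h x) :
    ∀ T ⊆ S \ {x, x'}, ∑ i ∈ T, π (h i) ≠ π τ + π τ := by
  intro T hT hsum
  have hTS : T ⊆ S := fun i hi => (Finset.mem_sdiff.mp (hT hi)).1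
  have hxT : x ∉ T := fun hi => (Finset.mem_sdiff.mp (hT hi)).2 (by simp)
  have hx'T : x' ∉ T := fun hi => (Finset.mem_sdiff.mp (hT hi)).2 (by simp)
  have hx'' : x ∉ insert x' T := by
    rw [Finset.mem_insert]; push Not; exact ⟨hxx', hxT⟩
  have hπ : π (∑ i ∈ T, h i - (τ + τ)) = 0 := by
    rw [map_sub, map_sum, map_add, hsum, sub_self]
  rcases hker _ hπ with h0 | h1 | h2
  · exact hgood T hTS (sub_eq_zero.mp h0)
  · have e : ∑ i ∈ T, h i = h x + (τ + τ) := by rw [sub_eq_iff_eq_add] at h1; exact h1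
    refine hgood (insert x (insert x' T)) ?_ ?_
    · exact Finset.insert_subset hx (Finset.insert_subset hx' hTS)
    · rw [Finset.sum_insert hx'', Finset.sum_insert hx'T, e, htwin, ← add_assoc, ← add_assoc, three,
        zero_add]
  · have e : ∑ i ∈ T, h i = h x + h x + (τ + τ) := by rw [sub_eq_iff_eq_add] at h2; exact h2
    refine hgood (insert x T) (Finset.insert_subset hx hTS) ?_
    rw [Finset.sum_insert hxT, e, show h x + (h x + h x + (τ + τ)) = (h x + h x + h x) + (τ + τ) by abel,
      three, zero_add]

/-- The four possible shapes of a set `M` with `M \ {x, x'} = U`. -/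
theorem soloBlind_sdiff_pair_cases {M U : Finset ι} {x x' : ι} (hU : M \ {x, x'} = U) :
    M = U ∨ M = insert x U ∨ M = insert x' U ∨ M = insert x (insert x' U) := by
  have key : ∀ i, i ∈ M ↔ i ∈ U ∨ (i = x ∧ x ∈ M) ∨ (i = x' ∧ x' ∈ M) := by
    intro i
    rw [← hU]
    simp only [Finset.mem_sdiff, Finset.mem_insert, Finset.mem_singleton]
    constructor
    · intro hi
      by_cases h1 : i = x
      · subst h1; exact Or.inr (Or.inl ⟨rfl, hi⟩)
      · by_cases h2 : i = x'
        · subst h2; exact Or.inr (Or.inr ⟨rfl, hi⟩)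
        · exact Or.inl ⟨hi, by tauto⟩
    · rintro (⟨hi, -⟩ | ⟨rfl, hi⟩ | ⟨rfl, hi⟩) <;> exact hi
  by_cases hxM : x ∈ M <;> by_cases hx'M : x' ∈ M
  · right; right; right
    ext i; rw [key i]; simp only [Finset.mem_insert]; tauto
  · right; left
    ext i; rw [key i]; simp only [Finset.mem_insert]; tauto
  · right; right; left
    ext i; rw [key i]; simp only [Finset.mem_insert]; tauto
  · left
    ext i; rw [key i]; tauto

/-- TWIN MOVE ON MASSES: if `h x' = h x` for `x ≠ x'` in `S` (`h` zero-sum free on `S`) and `π (h x) = 0`, then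
`E(τ; S) ≤ E'(π τ; S \ {x, x'})`, `E'` the mass of `π ∘ h`. -/
theorem soloBlind_mass_twin_move {h : ι → G} {S : Finset ι}
    (zsf : ∀ T ⊆ S, T.Nonempty → ∑ i ∈ T, h i ≠ 0) (τ : G) {x x' : ι} (hx : x ∈ S) (hx' : x' ∈ S)
    (hxx' : x ≠ x') (htwin : h x' = h x) (π : G →+ G') (hπx : π (h x) = 0) :
    soloBlindMass h S τ ≤ soloBlindMass (fun i => π (h i)) (S \ {x, x'}) (π τ) := by
  have hx0 : h x ≠ 0 := by
    have := zsf {x} (Finset.singleton_subset_iff.mpr hx) (Finset.singleton_nonempty x)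
    rwa [Finset.sum_singleton] at this
  have hxx0 : h x + h x ≠ 0 := by
    have hsub : ({x, x'} : Finset ι) ⊆ S := Finset.insert_subset hx (Finset.singleton_subset_iff.mpr hx')
    have := zsf {x, x'} hsub (Finset.insert_nonempty _ _)
    rwa [Finset.sum_pair hxx', htwin] at this
  have hxS' : x ∉ S \ {x, x'} := fun hi => (Finset.mem_sdiff.mp hi).2 (by simp)
  have hx'S' : x' ∉ S \ {x, x'} := fun hi => (Finset.mem_sdiff.mp hi).2 (by simp)
  set F := soloBlindSeqRepAll h S τ with hF
  set F' := soloBlindSeqRepAll (fun i => π (h i)) (S \ {x, x'}) (π τ) with hF'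
  set f : Finset ι → Finset ι := fun M => M \ {x, x'} with hf
  -- every member maps to a representation of `π τ`
  have hmaps : ∀ M ∈ F, f M ∈ F' := by
    intro M hM
    obtain ⟨hMS, hsum⟩ := soloBlind_mem_seqRepAll.mp hM
    refine soloBlind_mem_seqRepAll.mpr ⟨Finset.sdiff_subset_sdiff hMS (subset_refl _), ?_⟩
    have hzero : ∑ i ∈ M with i ∈ ({x, x'} : Finset ι), π (h i) = 0 := by
      refine Finset.sum_eq_zero ?_
      intro i hi
      obtain ⟨-, hiZ⟩ := Finset.mem_filter.mp hi
      rcases Finset.mem_insert.mp hiZ with rfl | hiZ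
      · exact hπx
      · rw [Finset.mem_singleton] at hiZ; rw [hiZ, htwin]; exact hπx
    have hsplit := Finset.sum_filter_add_sum_filter_not M (fun i => i ∈ ({x, x'} : Finset ι))
      (fun i => π (h i))
    rw [hzero, zero_add, ← Finset.sdiff_eq_filter] at hsplit
    · rw [hsplit, ← map_sum, hsum]
  -- fibre bound
  have hfib : ∀ U ∈ F', ∑ M ∈ F with f M = U, (1 / 2 : ℚ) ^ M.card ≤ (1 / 2 : ℚ) ^ U.card := by
    intro U hU
    obtain ⟨hUS, -⟩ := soloBlind_mem_seqRepAll.mp hU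
    have hxU : x ∉ U := fun hi => hxS' (hUS hi)
    have hx'U : x' ∉ U := fun hi => hx'S' (hUS hi)
    have hxU' : x ∉ insert x' U := by
      rw [Finset.mem_insert]; push Not; exact ⟨hxx', hxU⟩
    have s1 : ∑ i ∈ insert x U, h i = h x + ∑ i ∈ U, h i := Finset.sum_insert hxU
    have s2 : ∑ i ∈ insert x' U, h i = h x + ∑ i ∈ U, h i := by
      rw [Finset.sum_insert hx'U, htwin]
    have s3 : ∑ i ∈ insert x (insert x' U), h i = h x + h x + ∑ i ∈ U, h i := by
      rw [Finset.sum_insert hxU', Finset.sum_insert hx'U, htwin, add_assoc]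
    -- the members of the fibre and their sums
    have memfib : ∀ M ∈ F.filter (fun M => f M = U), ∑ i ∈ M, h i = τ ∧
        (M = U ∨ M = insert x U ∨ M = insert x' U ∨ M = insert x (insert x' U)) := by
      intro M hM
      obtain ⟨hMF, hMU⟩ := Finset.mem_filter.mp hM
      exact ⟨(soloBlind_mem_seqRepAll.mp hMF).2, soloBlind_sdiff_pair_cases hMU⟩
    have hnn : ∀ M ∈ ({U} : Finset (Finset ι)), M ∉ F.filter (fun M => f M = U) →
        (0 : ℚ) ≤ (1 / 2 : ℚ) ^ M.card := fun _ _ _ => by positivity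
    by_cases hA : ∑ i ∈ U, h i = τ
    · -- the fibre is `{U}`
      have hsub : F.filter (fun M => f M = U) ⊆ {U} := by
        intro M hM
        obtain ⟨hMsum, hc⟩ := memfib M hM
        rw [Finset.mem_singleton]
        rcases hc with e | e | e | e
        · exact e
        · exfalso; rw [e, s1, hA] at hMsum; exact hx0 (by simpa using hMsum)
        · exfalso; rw [e, s2, hA] at hMsum; exact hx0 (by simpa using hMsum)
        · exfalso; rw [e, s3, hA] at hMsum; exact hxx0 (by simpa using hMsum)
      calc ∑ M ∈ F with f M = U, (1 / 2 : ℚ) ^ M.card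
          ≤ ∑ M ∈ ({U} : Finset (Finset ι)), (1 / 2 : ℚ) ^ M.card :=
            Finset.sum_le_sum_of_subset_of_nonneg hsub (fun M _ _ => by positivity)
        _ = (1 / 2 : ℚ) ^ U.card := Finset.sum_singleton _ _
    · by_cases hB : h x + ∑ i ∈ U, h i = τ
      · -- the fibre is inside `{U ∪ {x}, U ∪ {x'}}`
        have hsub : F.filter (fun M => f M = U) ⊆ {insert x U, insert x' U} := by
          intro M hM
          obtain ⟨hMsum, hc⟩ := memfib M hM
          rw [Finset.mem_insert, Finset.mem_singleton]
          rcases hc with e | e | e | e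
          · exfalso; rw [e] at hMsum; exact hA hMsum
          · exact Or.inl e
          · exact Or.inr e
          · exfalso; rw [e, s3, add_assoc, hB] at hMsum; exact hx0 (by simpa using hMsum)
        have hne : insert x U ≠ insert x' U := by
          intro e
          have : x ∈ insert x' U := by rw [← e]; exact Finset.mem_insert_self x U
          exact hxU' this
        calc ∑ M ∈ F with f M = U, (1 / 2 : ℚ) ^ M.card
            ≤ ∑ M ∈ ({insert x U, insert x' U} : Finset (Finset ι)), (1 / 2 : ℚ) ^ M.card :=
              Finset.sum_le_sum_of_subset_of_nonneg hsub (fun M _ _ => by positivity)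
          _ = (1 / 2 : ℚ) ^ U.card := by
              rw [Finset.sum_pair hne, Finset.card_insert_of_notMem hxU, Finset.card_insert_of_notMem hx'U,
                pow_succ]
              ring
      · -- the fibre is inside `{U ∪ {x, x'}}`
        have hsub : F.filter (fun M => f M = U) ⊆ {insert x (insert x' U)} := by
          intro M hM
          obtain ⟨hMsum, hc⟩ := memfib M hM
          rw [Finset.mem_singleton]
          rcases hc with e | e | e | e
          · exfalso; rw [e] at hMsum; exact hA hMsum
          · exfalso; rw [e, s1] at hMsum; exact hB hMsum
          · exfalso; rw [e, s2] at hMsum; exact hB hMsum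
          · exact e
        calc ∑ M ∈ F with f M = U, (1 / 2 : ℚ) ^ M.card
            ≤ ∑ M ∈ ({insert x (insert x' U)} : Finset (Finset ι)), (1 / 2 : ℚ) ^ M.card :=
              Finset.sum_le_sum_of_subset_of_nonneg hsub (fun M _ _ => by positivity)
          _ = (1 / 2 : ℚ) ^ (U.card + 2) := by
              rw [Finset.sum_singleton, Finset.card_insert_of_notMem hxU', Finset.card_insert_of_notMem hx'U]
          _ ≤ (1 / 2 : ℚ) ^ U.card :=
              pow_le_pow_of_le_one (by norm_num) (by norm_num) (by omega)
  -- assemble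
  rw [soloBlindMass, soloBlindMass, ← hF, ← hF', ← Finset.sum_fiberwise_of_maps_to hmaps]
  exact Finset.sum_le_sum hfib

/-- CONJECTURE E REDUCES TO ZERO-SUM-FREE SETS (all ranks): if `E(σ; S') ≤ 1/2` for every exponent-`3` group (in
the universe of `G`), every `h'` zero-sum free AND INJECTIVE on `S'`, and every H-good `σ` all of whose
representations have size `≥ 3`, then `E(τ; S) ≤ 1/2` for every zero-sum-free sequence and every H-good `τ`. -/
theorem soloBlind_conjE_of_sets
    (hsets : ∀ {G : Type u} [AddCommGroup G] [DecidableEq G], (∀ g : G, g + g + g = 0) →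
      ∀ (h : ι → G) (S : Finset ι), (∀ T ⊆ S, T.Nonempty → ∑ i ∈ T, h i ≠ 0) →
      (∀ x ∈ S, ∀ x' ∈ S, h x = h x' → x = x') →
      ∀ τ : G, (∀ T ⊆ S, ∑ i ∈ T, h i ≠ τ + τ) →
      (∀ T ∈ soloBlindSeqRepAll h S τ, 3 ≤ T.card) → soloBlindMass h S τ ≤ 1 / 2)
    (three : ∀ g : G, g + g + g = 0) (h : ι → G) (S : Finset ι)
    (zsf : ∀ T ⊆ S, T.Nonempty → ∑ i ∈ T, h i ≠ 0) (τ : G)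
    (hgood : ∀ T ⊆ S, ∑ i ∈ T, h i ≠ τ + τ) : soloBlindMass h S τ ≤ 1 / 2 := by
  suffices H : ∀ n : ℕ, ∀ {G : Type u} [AddCommGroup G] [DecidableEq G], (∀ g : G, g + g + g = 0) →
      ∀ (h : ι → G) (S : Finset ι), S.card ≤ n → (∀ T ⊆ S, T.Nonempty → ∑ i ∈ T, h i ≠ 0) →
      ∀ τ : G, (∀ T ⊆ S, ∑ i ∈ T, h i ≠ τ + τ) → soloBlindMass h S τ ≤ 1 / 2 from
    H S.card three h S le_rfl zsf τ hgood
  intro n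
  induction n using Nat.strong_induction_on with
  | _ n ih =>
    intro G _ _ three h S hSn zsf τ hgood
    classical
    by_cases hsmall : ∃ T ∈ soloBlindSeqRepAll h S τ, T.card ≤ 2
    · obtain ⟨T, hT, hTc⟩ := hsmall
      have hc0 := soloBlind_repAll_card_ne_zero hgood hT
      obtain ⟨hTS, hTsum⟩ := soloBlind_mem_seqRepAll.mp hT
      by_cases hc1 : T.card = 1
      · obtain ⟨p, rfl⟩ := Finset.card_eq_one.mp hc1
        rw [Finset.sum_singleton] at hTsum
        rw [soloBlind_mass_of_value zsf hgood (hTS (Finset.mem_singleton_self p)) hTsum]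
      · have hc2 : T.card = 2 := by omega
        obtain ⟨x, y, hxy, rfl⟩ := Finset.card_eq_two.mp hc2
        have hP : ({x, y} : Finset ι) ∈ soloBlindSeqRep h S 2 τ :=
          soloBlind_mem_seqRep.mpr ⟨hTS, hc2, hTsum⟩
        have hker := soloBlind_quot_ker three (h y - h x)
        have hπ := soloBlind_quot_pair (h x) (h y)
        have three' := soloBlind_quot_three three (AddSubgroup.zmultiples (h y - h x))
        have zsf' := soloBlind_move_zsf three zsf hgood hP _ hker
        have hgood' := soloBlind_move_hgood three zsf hgood hP _ hker
        have hmove := soloBlind_mass_pair_move three zsf hgood hP _ hπ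
        have hcard : (S \ {x, y}).card < n := by
          have := Finset.card_sdiff_add_card_eq_card hTS
          rw [hc2] at this
          omega
        have ih' := ih _ hcard three' _ (S \ {x, y}) le_rfl zsf' _ hgood'
        linarith
    · push Not at hsmall
      by_cases htwin : ∃ x ∈ S, ∃ x' ∈ S, x ≠ x' ∧ h x' = h x
      · -- the twin move in `G ⧸ ℤ(h x)`
        obtain ⟨x, hx, x', hx', hxx', htw⟩ := htwin
        have hker := soloBlind_quot_ker three (h x)
        have three' := soloBlind_quot_three three (AddSubgroup.zmultiples (h x))
        have hπx : QuotientAddGroup.mk' (AddSubgroup.zmultiples (h x)) (h x) = 0 :=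
          (QuotientAddGroup.eq_zero_iff _).mpr (AddSubgroup.mem_zmultiples _)
        have zsf' := soloBlind_twin_zsf three zsf hx hx' hxx' htw _ hker
        have hgood' := soloBlind_twin_hgood three hgood hx hx' hxx' htw _ hker
        have hmove := soloBlind_mass_twin_move zsf τ hx hx' hxx' htw _ hπx
        have hsub : ({x, x'} : Finset ι) ⊆ S := Finset.insert_subset hx (Finset.singleton_subset_iff.mpr hx')
        have hcard : (S \ {x, x'}).card < n := by
          have := Finset.card_sdiff_add_card_eq_card hsub
          rw [Finset.card_pair hxx'] at this
          omega
        have ih' := ih _ hcard three' _ (S \ {x, x'}) le_rfl zsf' _ hgood'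
        exact le_trans hmove ih'
      · push Not at htwin
        refine hsets three h S zsf ?_ τ hgood (fun T hT => by have := hsmall T hT; omega)
        intro a ha b hb e
        by_contra hab
        exact htwin a ha b hb hab e.symm

end Summit.MatrixMultiplication.MatrixMultiplication.Theorems
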